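import Mathlib.Data.Finite.Sum
import Literature.AnabelianGeometry.SemiGraphs.FreeGroupsAndActionsProofs
import Literature.AnabelianGeometry.SemiGraphs.TreeFixedPoint

/-!
# Free groups and finite group actions on semi-graphs: proofs, IV ([SemiAnbd] §1, Lemma 1.8 (ii)(a), p. 20)

Mochizuki, *Semi-graphs of Anabelioids*, Publ. RIMS **42** (2006) 221–322, §1, author's manuscript
pp. 20–21 [cite: MochizukiSemiAnbd2006, §1 pp.20-21].  Proof-only companion of
`FreeGroupsAndActions.lean`, continuing `FreeGroupsAndActionsProofs.lean` (Lemma 1.8 (i)):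

* `lemma_1_8_ii_a_holds` — Lemma 1.8 (ii)(a): a finite group acting on a tree fixes a vertex or an
  edge.  As printed, "(a) follows formally from [Serre], Chapter I, §6.5 … by “splitting” each edge
  … into two new edges, corresponding to the two branches": we work in the barycentric subdivision
  (whose nodes are the vertices, edges and branches), take a finite connected `Γ`-stable
  sub-semi-graph (Lemma 1.8 (i)), and apply the leaf-stripping fixed-point lemma
  `TreeFixedPoint.exists_fixed_or_invariant_edge` to its set of nodes; a fixed node is a fixed
  vertex, a fixed edge, or a fixed branch (whose edge is then fixed), and an invariant edge of the
  subdivision has both ends fixed since the action preserves the type of a node.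
-/

namespace Literature.AnabelianGeometry.SemiGraphs

open CategoryTheory

universe u

namespace SemiGraph

variable {G : SemiGraph.{u}}

/-- Adjacency of the subdivision is respected in both directions by the action of an automorphism.
[cite: MochizukiSemiAnbd2006, Lem. 1.8(ii) p.20] -/
theorem nodeMap_adj_iff (σ : Aut G) (x y : G.Node) :
    G.subdivision.Adj x y ↔ G.subdivision.Adj (nodeMap σ x) (nodeMap σ y) := by
  refine ⟨fun h => subdivision_adj_nodeMap σ h, fun h => ?_⟩
  have h' := subdivision_adj_nodeMap σ.symm h
  rwa [nodeMap_symm_nodeMap, nodeMap_symm_nodeMap] at h'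

/-- The action of an automorphism on nodes preserves the type (vertex / edge / branch) of a node; in
particular it cannot exchange two adjacent nodes. [cite: MochizukiSemiAnbd2006, Lem. 1.8(ii) p.20] -/
theorem nodeMap_ne_of_adj (σ : Aut G) {x y : G.Node} (h : G.subdivision.Adj x y) :
    nodeMap σ x ≠ y := by
  rw [subdivision_adj_iff] at h
  rcases h with (⟨b⟩ | ⟨b, v, _⟩) | (⟨b⟩ | ⟨b, v, _⟩)
  · simp [nodeMap]
  · simp [nodeMap]
  · simp [nodeMap]
  · simp [nodeMap]

/-- A node of the subdivision fixed by the whole group yields a fixed vertex or a fixed edge of `G`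
(the edge of a fixed branch is fixed). [cite: MochizukiSemiAnbd2006, Lem. 1.8(ii)(a) p.20] -/
theorem fixed_vertex_or_edge_of_fixed_node {Γ : Type u} [Group Γ] (ρ : Γ →* Aut G) {x : G.Node}
    (hx : ∀ γ : Γ, nodeMap (ρ γ) x = x) :
    (∃ v : G.Vertex, ∀ γ, (ρ γ).hom.vertexMap v = v) ∨
      ∃ e : G.Edge, ∀ γ, (ρ γ).hom.edgeMap e = e := by
  rcases x with v | e | b
  · exact Or.inl ⟨v, fun γ => Sum.inl.inj (hx γ)⟩
  · exact Or.inr ⟨e, fun γ => Sum.inl.inj (Sum.inr.inj (hx γ))⟩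
  · refine Or.inr ⟨G.edgeOf b, fun γ => ?_⟩
    have hb : (ρ γ).hom.branchMap b = b := Sum.inr.inj (Sum.inr.inj (hx γ))
    rw [← (ρ γ).hom.edgeOf_branchMap, hb]

/-- The branches over a finite set of edges form a finite set (each edge has two branches).
[cite: MochizukiSemiAnbd2006, §1 p.11] -/
theorem finite_branches_of_finite_edges {E : Set G.Edge} (hE : E.Finite) :
    {b : G.Branch | G.edgeOf b ∈ E}.Finite := by
  refine hE.preimage' fun e _ => ?_
  obtain ⟨b₁, b₂, _, _, _, hall⟩ := G.two_branches e
  refine ((Set.finite_singleton b₂).insert b₁).subset ?_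
  intro b hb
  rcases hall b hb with rfl | rfl
  · exact Or.inl rfl
  · exact Or.inr rfl

/-- DISCHARGE of the named fact `lemma_1_8_ii_a` ([SemiAnbd] Lemma 1.8 (ii)(a)): `G` a tree with an
action of a finite group `Γ`; "there exists at least one vertex or edge of `G` that is fixed by
`Γ`." [cite: MochizukiSemiAnbd2006, Lem. 1.8(ii)(a) p.20] -/
theorem lemma_1_8_ii_a_holds : lemma_1_8_ii_a.{u} := by
  intro G Γ _ _ ρ hT
  classical
  -- a finite connected `Γ`-stable sub-semi-graph, by Lemma 1.8 (i) applied to the empty one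
  have hconnG : G.IsConnected := ⟨hT.isTree.connected⟩
  obtain ⟨K, hKfin, hKconn, -, hKstab⟩ :=
    lemma_1_8_i_holds G Γ ρ hconnG ⟨∅, ∅⟩ ⟨Set.finite_empty, Set.finite_empty⟩
  -- the set `S` of its nodes
  let ι : K.toSemiGraph.Node → G.Node := Sum.map K.ι.vertexMap (Sum.map K.ι.edgeMap K.ι.branchMap)
  let S : Set G.Node := Set.range ι
  have hSfin : S.Finite := by
    haveI : Finite K.toSemiGraph.Vertex := hKfin.1.to_subtype
    haveI : Finite K.toSemiGraph.Edge := hKfin.2.to_subtype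
    haveI : Finite K.toSemiGraph.Branch := (finite_branches_of_finite_edges hKfin.2).to_subtype
    exact Set.finite_range ι
  obtain ⟨z₀⟩ := hKconn.connected.nonempty
  have hSne : S.Nonempty := ⟨ι z₀, z₀, rfl⟩
  -- `S` induces a connected subgraph of the subdivision
  have hSconn : (G.subdivision.induce S).Connected := by
    rw [SimpleGraph.connected_iff]
    refine ⟨?_, ⟨⟨ι z₀, z₀, rfl⟩⟩⟩
    rintro ⟨x, x', rfl⟩ ⟨y, y', rfl⟩
    obtain ⟨p⟩ := hKconn.connected x' y'
    let f : K.toSemiGraph.subdivision →g G.subdivision := ⟨ι, fun h => subdivision_adj_map K.ι h⟩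
    have hsupp : ∀ z ∈ (p.map f).support, z ∈ S := by
      intro z hz
      rw [SimpleGraph.Walk.support_map, List.mem_map] at hz
      obtain ⟨w, -, rfl⟩ := hz
      exact ⟨w, rfl⟩
    exact ⟨(p.map f).induce S hsupp⟩
  -- membership in `S` of the three kinds of nodes
  have hSv : ∀ v : G.Vertex, (Sum.inl v : G.Node) ∈ S ↔ v ∈ K.verts := K.inl_mem_range_iff
  have hSe : ∀ e : G.Edge, (Sum.inr (Sum.inl e) : G.Node) ∈ S ↔ e ∈ K.edges := K.edge_mem_range_iff
  have hSb : ∀ b : G.Branch, (Sum.inr (Sum.inr b) : G.Node) ∈ S ↔ G.edgeOf b ∈ K.edges :=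
    K.branch_mem_range_iff
  -- the group elements preserve membership in `K`
  have hKv : ∀ (γ : Γ) (v : G.Vertex), v ∈ K.verts ↔ (ρ γ).hom.vertexMap v ∈ K.verts := by
    intro γ v
    have h := congrArg Subgraph.verts (hKstab γ)
    change (ρ γ).hom.vertexMap '' K.verts = K.verts at h
    constructor
    · intro hv
      rw [← h]
      exact ⟨v, hv, rfl⟩
    · intro hv
      rw [← h] at hv
      obtain ⟨v', hv', hvv⟩ := hv
      have : v' = v := Sum.inl.inj (nodeMap_injective (ρ γ)
        (show nodeMap (ρ γ) (Sum.inl v') = nodeMap (ρ γ) (Sum.inl v) from congrArg Sum.inl hvv))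
      exact this ▸ hv'
  have hKe : ∀ (γ : Γ) (e : G.Edge), e ∈ K.edges ↔ (ρ γ).hom.edgeMap e ∈ K.edges := by
    intro γ e
    have h := congrArg Subgraph.edges (hKstab γ)
    change (ρ γ).hom.edgeMap '' K.edges = K.edges at h
    constructor
    · intro he
      rw [← h]
      exact ⟨e, he, rfl⟩
    · intro he
      rw [← h] at he
      obtain ⟨e', he', hee⟩ := he
      have : e' = e := Sum.inl.inj (Sum.inr.inj (nodeMap_injective (ρ γ)
        (show nodeMap (ρ γ) (Sum.inr (Sum.inl e')) = nodeMap (ρ γ) (Sum.inr (Sum.inl e)) from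
          congrArg (fun e => (Sum.inr (Sum.inl e) : G.Node)) hee)))
      exact this ▸ he'
  have hSiff : ∀ (γ : Γ) (x : G.Node), x ∈ S ↔ nodeMap (ρ γ) x ∈ S := by
    intro γ x
    rcases x with v | e | b
    · rw [hSv, hKv γ v]
      exact (hSv _).symm
    · rw [hSe, hKe γ e]
      exact (hSe _).symm
    · rw [hSb, hKe γ (G.edgeOf b), ← (ρ γ).hom.edgeOf_branchMap]
      exact (hSb _).symm
  -- the family of maps and its properties
  let Φ : Set (G.Node → G.Node) := Set.range fun γ : Γ => nodeMap (ρ γ)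
  have hΦ : ∀ φ ∈ Φ, Function.Injective φ ∧
      ∀ x y, G.subdivision.Adj x y ↔ G.subdivision.Adj (φ x) (φ y) := by
    rintro φ ⟨γ, rfl⟩
    exact ⟨nodeMap_injective (ρ γ), nodeMap_adj_iff (ρ γ)⟩
  have hΦS : ∀ φ ∈ Φ, (∀ x, x ∈ S ↔ φ x ∈ S) ∧ (∀ y ∈ S, ∃ x ∈ S, φ x = y) := by
    rintro φ ⟨γ, rfl⟩
    refine ⟨hSiff γ, fun y hy => ⟨nodeMap (ρ γ⁻¹) y, (hSiff γ⁻¹ y).mp hy, ?_⟩⟩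
    change nodeMap (ρ γ) (nodeMap (ρ γ⁻¹) y) = y
    rw [← nodeMap_mul, ← map_mul, mul_inv_cancel, map_one]
    rcases y with v | e | b <;> rfl
  -- the fixed-point lemma
  rcases TreeFixedPoint.exists_fixed_or_invariant_edge hT.isTree.isAcyclic Φ hΦ S.ncard S rfl hSfin
      hSne hSconn hΦS with ⟨x, -, hfix⟩ | ⟨x, -, y, -, hxy, hfix⟩
  · exact fixed_vertex_or_edge_of_fixed_node ρ fun γ => hfix _ ⟨γ, rfl⟩
  · refine fixed_vertex_or_edge_of_fixed_node ρ (x := x) fun γ => ?_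
    rcases hfix _ ⟨γ, rfl⟩ with ⟨h, -⟩ | ⟨h, -⟩
    · exact h
    · exact absurd h (nodeMap_ne_of_adj (ρ γ) hxy)

end SemiGraph

end Literature.AnabelianGeometry.SemiGraphs
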